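import Summits.Ventures.PercRepro.C025Profile

/-!
# PercRepro — THE SKEW-DECOMPOSITION IDENTITY behind the profile inequality (p10, gen 0; S5, Lemma 1)

`proofs/SUBCLAIM-S5-p10.md` §2.4, Lemma 1: for every finite matroid `M` on `E` and all `q ≤ u`,

  `Σ_{B ⊆ E : ρ(B) = q}  #{Y ⊆ E ∖ B : |Y| = u − q, ρ(B ∪ Y) = ρ(B) + |Y|}  =  Σ_{S ⊆ E : ρ(S) = u}  C(c(S), u − q)`,

where `c(S)` is the number of coloops of `M|S` (night-2's `Shadow.coloops`).  Both sides count the pairs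
`(B, Y)` with `B ∩ Y = ∅`, `ρ(B) = q`, `|Y| = u − q` and `ρ(B ∪ Y) = ρ(B) + |Y|`: on the left by `B`, on the
right by `S := B ∪ Y`, whose decompositions are exactly `B = (S ∖ coloops S) ∪ Z`, `Y = coloops S ∖ Z` for
`Z ⊆ coloops S` with `|Z| + u = q + c(S)` (every element of `Y` is a coloop of `B ∪ Y`, and removing a set
of coloops drops the rank by exactly its size).

The inner count on the left is the number of independent `(u − q)`-sets of the contraction `M/B` on `E ∖ B`;
the profile price `C(ρ(E∖B), u − q)/C(u, q)` of `C025Profile` counts the `(u − q)`-subsets of one basis of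
`E ∖ B` instead, so `(Π_{q,u})` is equivalent to «total deficiency ≤ total surplus»
(`C(u,q) − C(c(S), u−q)` on the rank-`u` sets, zero exactly on the sets all of whose elements are coloops).

* `skewExt M B j` — the skew extensions `Y ⊆ gr M ∖ B` of size `j` (`ρ(B ∪ Y) = ρ(B) + j`);
* `colSel M S q u` — the coloop selections `Z ⊆ coloops M S` with `|Z| + u = q + c(S)`;
* `eRk_erase_add_one_of_mem_coloops`, `eRk_sdiff_add_card_of_subset_coloops` — removing coloops drops the
  rank by exactly their number; `subset_coloops_union_of_skew` — a skew extension consists of coloops;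
* **`sum_card_skewExt_eq_sum_choose`** — the identity.
-/

namespace PercRepro.Skew

open Finset ThmH Shadow Profile

variable {α : Type*} [DecidableEq α] {M : Matroid α} [M.Finite]

omit [DecidableEq α] [M.Finite] in
/-- The rank of a finset is finite. -/
theorem eRk_coe_ne_top (X : Finset α) : M.eRk (X : Set α) ≠ ⊤ := by
  apply ne_top_of_le_ne_top _ (M.eRk_le_encard _)
  rw [Set.encard_coe_eq_coe_finsetCard]
  exact ENat.coe_ne_top _

/-- Removing a coloop of `S` drops the rank by exactly one. -/
theorem eRk_erase_add_one_of_mem_coloops {S : Finset α} (hS : S ⊆ gr M) {z : α}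
    (hz : z ∈ coloops M S) :
    M.eRk ((S.erase z : Finset α) : Set α) + 1 = M.eRk (S : Set α) := by
  rw [mem_coloops] at hz
  obtain ⟨hzS, hzcl⟩ := hz
  have hzE : z ∈ M.E := by
    rw [← coe_gr]
    exact_mod_cast hS hzS
  have hzcl' : z ∉ M.closure ((S.erase z : Finset α) : Set α) := by
    rw [← coe_clF]
    exact_mod_cast hzcl
  have h := M.eRk_insert_eq_add_one (X := ((S.erase z : Finset α) : Set α)) ⟨hzE, hzcl'⟩
  rw [← h, ← Finset.coe_insert, Finset.insert_erase hzS]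

/-- A coloop of `S` lying in `T ⊆ S` is a coloop of `T`. -/
theorem mem_coloops_of_subset {S T : Finset α} (hTS : T ⊆ S) {z : α} (hzT : z ∈ T)
    (hz : z ∈ coloops M S) : z ∈ coloops M T := by
  rw [mem_coloops] at hz ⊢
  refine ⟨hzT, fun h => hz.2 ?_⟩
  have hsub : ((T.erase z : Finset α) : Set α) ⊆ ((S.erase z : Finset α) : Set α) := by
    exact_mod_cast Finset.erase_subset_erase z hTS
  rw [← Finset.mem_coe, coe_clF] at h ⊢
  exact M.closure_subset_closure hsub h

/-- Removing a set of coloops of `S` drops the rank by exactly its size. -/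
theorem eRk_sdiff_add_card_of_subset_coloops {S : Finset α} (hS : S ⊆ gr M) (Y : Finset α)
    (hY : Y ⊆ coloops M S) :
    M.eRk ((S \ Y : Finset α) : Set α) + (Y.card : ℕ∞) = M.eRk (S : Set α) := by
  revert hY
  induction Y using Finset.induction_on with
  | empty => intro _; simp
  | insert y Y' hy ih =>
    intro hY
    have hY' : Y' ⊆ coloops M S := (Finset.subset_insert _ _).trans hY
    have hyS : y ∈ coloops M S := hY (Finset.mem_insert_self _ _)
    have hySY' : y ∈ S \ Y' := by
      rw [Finset.mem_sdiff]
      exact ⟨(mem_coloops.1 hyS).1, hy⟩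
    have hycol : y ∈ coloops M (S \ Y') := mem_coloops_of_subset Finset.sdiff_subset hySY' hyS
    have h1 := eRk_erase_add_one_of_mem_coloops (Finset.sdiff_subset.trans hS) hycol
    have h2 : S \ insert y Y' = (S \ Y').erase y := by
      ext x
      simp only [Finset.mem_sdiff, Finset.mem_erase, Finset.mem_insert, not_or]
      tauto
    rw [h2, Finset.card_insert_of_notMem hy, Nat.cast_succ, add_comm (Y'.card : ℕ∞) 1, ← add_assoc, h1,
      ih hY']

/-- The elements of a skew extension `Y` of `B` (`ρ(B ∪ Y) = ρ(B) + |Y|`, `Y ∩ B = ∅`) are coloops of `B ∪ Y`. -/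
theorem subset_coloops_union_of_skew {B Y : Finset α} (hB : B ⊆ gr M) (hY : Y ⊆ gr M \ B)
    (hr : M.eRk ((B ∪ Y : Finset α) : Set α) = M.eRk (B : Set α) + (Y.card : ℕ∞)) :
    Y ⊆ coloops M (B ∪ Y) := by
  intro y hy
  rw [mem_coloops]
  refine ⟨Finset.mem_union_right _ hy, fun hcl => ?_⟩
  have hyB : y ∉ B := (Finset.mem_sdiff.1 (hY hy)).2
  have h1 : (B ∪ Y).erase y = B ∪ Y.erase y := by
    ext x
    simp only [Finset.mem_erase, Finset.mem_union]
    constructor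
    · rintro ⟨hx, hxB | hxY⟩
      · exact Or.inl hxB
      · exact Or.inr ⟨hx, hxY⟩
    · rintro (hxB | ⟨hx, hxY⟩)
      · exact ⟨fun h => hyB (h ▸ hxB), Or.inl hxB⟩
      · exact ⟨hx, Or.inr hxY⟩
  -- `y ∈ cl((B ∪ Y) ∖ y)` forces `ρ(B ∪ Y) ≤ ρ((B ∪ Y) ∖ y)`
  have hle : M.eRk ((B ∪ Y : Finset α) : Set α) ≤ M.eRk (((B ∪ Y).erase y : Finset α) : Set α) := by
    have hsub : ((B ∪ Y : Finset α) : Set α) ⊆ M.closure (((B ∪ Y).erase y : Finset α) : Set α) := by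
      intro x hx
      by_cases hxy : x = y
      · subst hxy
        rw [← coe_clF]
        exact_mod_cast hcl
      · have hE : (((B ∪ Y).erase y : Finset α) : Set α) ⊆ M.E := by
          rw [← coe_gr]
          intro z hz
          rw [Finset.mem_coe] at hz ⊢
          rcases Finset.mem_union.1 (Finset.mem_of_mem_erase hz) with hzB | hzY
          · exact hB hzB
          · exact (Finset.mem_sdiff.1 (hY hzY)).1
        apply M.mem_closure_of_mem _ hE
        rw [Finset.mem_coe, Finset.mem_erase]
        exact ⟨hxy, by exact_mod_cast hx⟩
    calc M.eRk ((B ∪ Y : Finset α) : Set α)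
        ≤ M.eRk (M.closure (((B ∪ Y).erase y : Finset α) : Set α)) := M.eRk_mono hsub
      _ = M.eRk (((B ∪ Y).erase y : Finset α) : Set α) := M.eRk_closure_eq _
  -- but `ρ((B ∪ Y) ∖ y) ≤ ρ(B) + |Y| − 1 < ρ(B) + |Y| = ρ(B ∪ Y)`
  have hle2 : M.eRk (((B ∪ Y).erase y : Finset α) : Set α) ≤ M.eRk (B : Set α) + ((Y.erase y).card : ℕ∞) := by
    rw [h1, Finset.coe_union]
    calc M.eRk ((B : Set α) ∪ ((Y.erase y : Finset α) : Set α))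
        ≤ M.eRk (B : Set α) + M.eRk ((Y.erase y : Finset α) : Set α) := M.eRk_union_le_eRk_add_eRk _ _
      _ ≤ M.eRk (B : Set α) + ((Y.erase y).card : ℕ∞) := by
          gcongr
          rw [← Set.encard_coe_eq_coe_finsetCard]
          exact M.eRk_le_encard _
  have hlt : M.eRk (B : Set α) + ((Y.erase y).card : ℕ∞) < M.eRk (B : Set α) + (Y.card : ℕ∞) := by
    rw [ENat.add_lt_add_iff_left (eRk_coe_ne_top B)]
    exact_mod_cast Finset.card_erase_lt_of_mem hy
  exact absurd (hr ▸ hle.trans hle2) (not_le.2 hlt)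

/-! ## The two sides of the identity -/

variable (M)

open scoped Classical in
/-- The skew extensions of `B` of size `j`: `Y ⊆ gr M ∖ B` with `|Y| = j` and `ρ(B ∪ Y) = ρ(B) + j`
(the independent `j`-sets of the contraction `M/B` on `E ∖ B`). -/
noncomputable def skewExt (B : Finset α) (j : ℕ) : Finset (Finset α) :=
  (gr M \ B).powerset.filter
    (fun Y => Y.card = j ∧ M.eRk ((B ∪ Y : Finset α) : Set α) = M.eRk (B : Set α) + (j : ℕ∞))

open scoped Classical in
/-- The coloop selections of `S` at `(q, u)`: `Z ⊆ coloops M S` with `|Z| + u = q + c(S)`. -/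
noncomputable def colSel (S : Finset α) (q u : ℕ) : Finset (Finset α) :=
  (coloops M S).powerset.filter (fun Z => Z.card + u = q + (coloops M S).card)

variable {M}

/-- Membership in `skewExt`. -/
theorem mem_skewExt {B Y : Finset α} {j : ℕ} :
    Y ∈ skewExt M B j ↔
      Y ⊆ gr M \ B ∧ Y.card = j ∧ M.eRk ((B ∪ Y : Finset α) : Set α) = M.eRk (B : Set α) + (j : ℕ∞) := by
  unfold skewExt
  simp only [Finset.mem_filter, Finset.mem_powerset]

/-- Membership in `colSel`. -/
theorem mem_colSel {S Z : Finset α} {q u : ℕ} :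
    Z ∈ colSel M S q u ↔ Z ⊆ coloops M S ∧ Z.card + u = q + (coloops M S).card := by
  unfold colSel
  simp only [Finset.mem_filter, Finset.mem_powerset]

/-- The number of coloop selections is a binomial coefficient. -/
theorem card_colSel (S : Finset α) (q u : ℕ) (hqu : q ≤ u) :
    (colSel M S q u).card = (coloops M S).card.choose (u - q) := by
  by_cases h : u ≤ q + (coloops M S).card
  · have heq : colSel M S q u = (coloops M S).powersetCard (q + (coloops M S).card - u) := by
      ext Z
      rw [mem_colSel, Finset.mem_powersetCard]
      constructor
      · rintro ⟨h1, h2⟩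
        exact ⟨h1, by omega⟩
      · rintro ⟨h1, h2⟩
        exact ⟨h1, by omega⟩
    rw [heq, Finset.card_powersetCard]
    exact Nat.choose_symm_of_eq_add (by omega)
  · rw [not_le] at h
    have heq : colSel M S q u = ∅ := by
      ext Z
      rw [mem_colSel]
      simp only [Finset.notMem_empty, iff_false, not_and]
      intro _
      omega
    rw [heq, Finset.card_empty, Nat.choose_eq_zero_of_lt (by omega)]

/-- **The skew-decomposition identity** (S5, Lemma 1): for `q ≤ u`,
`Σ_{B : ρ(B) = q} #skewExt B (u − q) = Σ_{S : ρ(S) = u} C(c(S), u − q)`. -/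
theorem sum_card_skewExt_eq_sum_choose (q u : ℕ) (hqu : q ≤ u) :
    ∑ B ∈ Rq M q, (skewExt M B (u - q)).card =
      ∑ S ∈ levelSet M u, (coloops M S).card.choose (u - q) := by
  classical
  rw [← Finset.card_sigma]
  rw [Finset.sum_congr rfl (fun S _ => (card_colSel S q u hqu).symm), ← Finset.card_sigma]
  -- the bijection `(B, Y) ↦ (B ∪ Y, B ∩ coloops(B ∪ Y))`, inverse `(S, Z) ↦ ((S ∖ coloops S) ∪ Z, coloops S ∖ Z)`
  refine Finset.card_nbij' (fun x => ⟨x.1 ∪ x.2, x.1 ∩ coloops M (x.1 ∪ x.2)⟩)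
    (fun y => ⟨(y.1 \ coloops M y.1) ∪ y.2, coloops M y.1 \ y.2⟩) ?_ ?_ ?_ ?_
  · -- forward map lands in the right sigma
    rintro ⟨B, Y⟩ hx
    simp only [Finset.mem_coe, Finset.mem_sigma] at hx ⊢
    obtain ⟨hB, hY⟩ := hx
    rw [mem_Rq] at hB
    rw [mem_skewExt] at hY
    obtain ⟨hBg, hBq⟩ := hB
    obtain ⟨hYg, hYc, hYr⟩ := hY
    have hYr' : M.eRk ((B ∪ Y : Finset α) : Set α) = M.eRk (B : Set α) + (Y.card : ℕ∞) := by
      rw [hYc]; exact hYr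
    have hcol : Y ⊆ coloops M (B ∪ Y) := subset_coloops_union_of_skew hBg hYg hYr'
    refine ⟨?_, ?_⟩
    · rw [mem_levelSet]
      refine ⟨Finset.union_subset hBg (fun y hy => (Finset.mem_sdiff.1 (hYg hy)).1), ?_⟩
      rw [hYr, hBq, ← Nat.cast_add, Nat.add_sub_cancel' hqu]
    · rw [mem_colSel]
      refine ⟨Finset.inter_subset_right, ?_⟩
      have hunion : coloops M (B ∪ Y) = (B ∩ coloops M (B ∪ Y)) ∪ Y := by
        ext x
        simp only [Finset.mem_union, Finset.mem_inter]
        constructor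
        · intro hx
          rcases Finset.mem_union.1 (mem_coloops.1 hx).1 with hxB | hxY
          · exact Or.inl ⟨hxB, hx⟩
          · exact Or.inr hxY
        · rintro (⟨_, hx⟩ | hx)
          · exact hx
          · exact hcol hx
      have hdisj : Disjoint (B ∩ coloops M (B ∪ Y)) Y := by
        rw [Finset.disjoint_left]
        intro x hx hxY
        exact (Finset.mem_sdiff.1 (hYg hxY)).2 (Finset.mem_inter.1 hx).1
      have hc : (coloops M (B ∪ Y)).card = (B ∩ coloops M (B ∪ Y)).card + Y.card := by
        conv_lhs => rw [hunion]
        exact Finset.card_union_of_disjoint hdisj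
      rw [hc, hYc]
      omega
  · -- inverse map lands in the right sigma
    rintro ⟨S, Z⟩ hy
    simp only [Finset.mem_coe, Finset.mem_sigma] at hy ⊢
    obtain ⟨hS, hZ⟩ := hy
    rw [mem_levelSet] at hS
    rw [mem_colSel] at hZ
    obtain ⟨hSg, hSu⟩ := hS
    obtain ⟨hZc, hZcard⟩ := hZ
    have hcolS : coloops M S ⊆ S := fun x hx => (mem_coloops.1 hx).1
    have hZS : Z ⊆ S := hZc.trans hcolS
    have hBeq : (S \ coloops M S) ∪ Z = S \ (coloops M S \ Z) := by
      ext x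
      simp only [Finset.mem_union, Finset.mem_sdiff, not_and, not_not]
      constructor
      · rintro (⟨hxS, hxc⟩ | hxZ)
        · exact ⟨hxS, fun h => absurd h hxc⟩
        · exact ⟨hZS hxZ, fun _ => hxZ⟩
      · rintro ⟨hxS, h⟩
        by_cases hxc : x ∈ coloops M S
        · exact Or.inr (h hxc)
        · exact Or.inl ⟨hxS, hxc⟩
    have hYcard : (coloops M S \ Z).card = u - q := by
      rw [Finset.card_sdiff_of_subset hZc]
      omega
    have hrank := eRk_sdiff_add_card_of_subset_coloops hSg (coloops M S \ Z) Finset.sdiff_subset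
    rw [hYcard, hSu] at hrank
    have hBq : M.eRk (((S \ coloops M S) ∪ Z : Finset α) : Set α) = (q : ℕ∞) := by
      rw [hBeq]
      have : (u : ℕ∞) = (q : ℕ∞) + ((u - q : ℕ) : ℕ∞) := by
        rw [← Nat.cast_add, Nat.add_sub_cancel' hqu]
      rw [this] at hrank
      exact WithTop.add_right_cancel (ENat.coe_ne_top _) hrank
    refine ⟨?_, ?_⟩
    · rw [mem_Rq]
      exact ⟨Finset.union_subset (Finset.sdiff_subset.trans hSg) (hZS.trans hSg), hBq⟩
    · rw [mem_skewExt]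
      refine ⟨?_, hYcard, ?_⟩
      · intro x hx
        rw [Finset.mem_sdiff] at hx ⊢
        refine ⟨hSg (hcolS hx.1), ?_⟩
        simp only [Finset.mem_union, Finset.mem_sdiff, not_or, not_and, not_not]
        exact ⟨fun _ => hx.1, hx.2⟩
      · have hS' : (S \ coloops M S) ∪ Z ∪ (coloops M S \ Z) = S := by
          ext x
          simp only [Finset.mem_union, Finset.mem_sdiff]
          constructor
          · rintro ((⟨hxS, _⟩ | hxZ) | ⟨hxc, _⟩)
            · exact hxS
            · exact hZS hxZ
            · exact hcolS hxc
          · intro hxS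
            by_cases hxc : x ∈ coloops M S
            · by_cases hxZ : x ∈ Z
              · exact Or.inl (Or.inr hxZ)
              · exact Or.inr ⟨hxc, hxZ⟩
            · exact Or.inl (Or.inl ⟨hxS, hxc⟩)
        rw [hS', hSu, hBq, ← Nat.cast_add, Nat.add_sub_cancel' hqu]
  · -- left inverse
    rintro ⟨B, Y⟩ hx
    simp only [Finset.mem_coe, Finset.mem_sigma] at hx ⊢
    obtain ⟨hB, hY⟩ := hx
    rw [mem_Rq] at hB
    obtain ⟨hBg, _⟩ := hB
    rw [mem_skewExt] at hY
    obtain ⟨hYg, hYc, hYr⟩ := hY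
    have hYr' : M.eRk ((B ∪ Y : Finset α) : Set α) = M.eRk (B : Set α) + (Y.card : ℕ∞) := by
      rw [hYc]; exact hYr
    have hcol : Y ⊆ coloops M (B ∪ Y) := subset_coloops_union_of_skew hBg hYg hYr'
    have hYB : ∀ x ∈ Y, x ∉ B := fun x hx => (Finset.mem_sdiff.1 (hYg hx)).2
    have e1 : (B ∪ Y) \ coloops M (B ∪ Y) ∪ B ∩ coloops M (B ∪ Y) = B := by
      ext x
      simp only [Finset.mem_union, Finset.mem_sdiff, Finset.mem_inter]
      constructor
      · rintro (⟨hxBY | hxY, hxc⟩ | ⟨hxB, _⟩)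
        · exact hxBY
        · exact absurd (hcol hxY) hxc
        · exact hxB
      · intro hxB
        by_cases hxc : x ∈ coloops M (B ∪ Y)
        · exact Or.inr ⟨hxB, hxc⟩
        · exact Or.inl ⟨Or.inl hxB, hxc⟩
    have e2 : coloops M (B ∪ Y) \ (B ∩ coloops M (B ∪ Y)) = Y := by
      ext x
      simp only [Finset.mem_sdiff, Finset.mem_inter, not_and]
      constructor
      · rintro ⟨hxc, h⟩
        rcases Finset.mem_union.1 (mem_coloops.1 hxc).1 with hxB | hxY
        · exact absurd hxc (h hxB)
        · exact hxY
      · intro hxY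
        exact ⟨hcol hxY, fun hxB => absurd hxB (hYB x hxY)⟩
    exact Sigma.ext e1 (heq_of_eq e2)
  · -- right inverse
    rintro ⟨S, Z⟩ hy
    simp only [Finset.mem_coe, Finset.mem_sigma] at hy ⊢
    obtain ⟨_, hZ⟩ := hy
    rw [mem_colSel] at hZ
    obtain ⟨hZc, _⟩ := hZ
    have hcolS : coloops M S ⊆ S := fun x hx => (mem_coloops.1 hx).1
    have hZS : Z ⊆ S := hZc.trans hcolS
    have e1 : (S \ coloops M S) ∪ Z ∪ (coloops M S \ Z) = S := by
      ext x
      simp only [Finset.mem_union, Finset.mem_sdiff]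
      constructor
      · rintro ((⟨hxS, _⟩ | hxZ) | ⟨hxc, _⟩)
        · exact hxS
        · exact hZS hxZ
        · exact hcolS hxc
      · intro hxS
        by_cases hxc : x ∈ coloops M S
        · by_cases hxZ : x ∈ Z
          · exact Or.inl (Or.inr hxZ)
          · exact Or.inr ⟨hxc, hxZ⟩
        · exact Or.inl (Or.inl ⟨hxS, hxc⟩)
    have e2 : ((S \ coloops M S) ∪ Z) ∩ coloops M S = Z := by
      ext x
      simp only [Finset.mem_inter, Finset.mem_union, Finset.mem_sdiff]
      constructor
      · rintro ⟨⟨_, hxc⟩ | hxZ, hxc'⟩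
        · exact absurd hxc' hxc
        · exact hxZ
      · intro hxZ
        exact ⟨Or.inr hxZ, hZc hxZ⟩
    refine Sigma.ext e1 (heq_of_eq ?_)
    simp only
    rw [e1, e2]

end PercRepro.Skew
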